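import Literature.MathematicalPhysics.QuantumFieldTheory.Balaban1983to89.B9B8AveragingKernelZd
import Literature.MathematicalPhysics.QuantumFieldTheory.Balaban1983to89.B7Eq47AveragedBondVsStraight
import Literature.MathematicalPhysics.QuantumFieldTheory.Balaban1983to89.B8Eq119TwistedAxial
import Literature.MathematicalPhysics.QuantumFieldTheory.Balaban1983to89.B8Eq115GaugeFixing
import HarnessLib

/-!
# Route `UnitScaleTilt`, crux K1 (stmt-QuantumFields-19200), stub `stub_existenceMinimalOrbit` (EX), LANE II «divergence recovery at curved `W`» (★★OWNER RULING №23),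
# brick (B2a) sub-pen (B2a-F3) of ★p1 g19 — **PRINT'S COMB (HIERARCHICAL) TRANSPORTER IS `O(α₀)`-CLOSE TO THE ONE-SHOT AXIAL TRANSPORTER, UNIFORMLY IN THE NUMBER OF LEVELS**

Cell `ym3-torus`, width seat `ym3-torus-px5` (gen 6).  THEOREMS ONLY (0 `def`, 0 `sorry`); `--supports stmt-QuantumFields-19200 --as helper`, count-neutral.
YM₃ on T³ is a ladder rung (R3), not the Clay problem; nothing here claims the stub, the crux, d = 4 or the mass gap.

OBJECTS (on `ℤᵈ`, the letters of ✓`Prop7QprimeCombL2Defs.QprimeCombL2_apply` = `QprimeIter (zdBlocking d L) (bgT L W♯) (K − n) …`).  Print's `k`-fold comb site average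
[Balaban1985BackgroundPropagators] (3.19) is one kernel on the `Lᵏ`-block with the COMPOSITE transporter `compT L T k y x` (lit ✓`B9B8AveragingKernelZd.QprimeIter_zd_eq_sum_blockIter`);
for the background legs `T := bgT L V` (`bgT L V j y x′ = Ū^j(Γ_{Ly,x′})`, the axial transporter of the `j`-fold AVERAGED field from the block corner, [Balaban1985Averaging] (78)–(80))
`compT L (bgT L V) k y x` is the hierarchical («comb») transport from the corner of the `Lᵏ`-block of `y` to the fine site `x`; the one-shot object is the fine axial transporter
`axialFn V (blockBase (Lᵏ) y) x` of the ORIGINAL field.  THE ROW (§4): in print's class (52) (`|V(∂p) − 1| < α₀L^{−2k}` on `ℤᵈ`, values in an averaging-closed subgroup of the unit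
ball — the hypotheses of lit ✓`B7Eq47AveragedBondVsStraight.norm_avgIter_sub_straight_le` verbatim) the two differ by `≤ 87·d·(d+1)·(d+4)·α₀`, ABSOLUTE in `L` and `k`.
PROOF: induction on `k` (IH on the sub-block at `α₀∕L²`): the outer leg is within `d(L−1)·256(d+1)(d+4)α₀∕L²` of the fine corner→sub-corner transporter (lit tower + §2); the two nested
fine axial transporters against the one differ by `≤ d²α₀∕L` — in the axial gauge rooted at the big corner both corner-rooted tree transporters are `1` and the sub-corner tree path has
`≤ dLᵏ` bonds each within `dL^{k+1}·α₀L^{−2(k+1)}` of `1` (lit ✓`axial_bond_bound_sharp`; the «fat loop» is paid by the axial-gauge ladder, §3); `C∕L² + 64d(d+1)(d+4) + d²∕2 ≤ C`.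
WHAT IS PROVED (ns `…Theorems.Prop7CombVsAxialTransport`): §1 letters `norm_units_mul_sub_mul_le`, ★`norm_hol_sub_one_le_length_mul`, `l1_le_mul_of_le`, `exists_offset_of_mem_blockSites`,
`iterate_blockMap_eq`, `smul_blockBase`; §2 ★`norm_hol_tw_sub_hol_tw_smul_le`, ★★`norm_hol_treeWord_sub_hol_treeWord_le`; §3 ★★`norm_axialFn_mul_axialFn_sub_axialFn_le`; §4 `closing_arith`,
★`norm_bgT_sub_axialFn_le` (outer leg), ★`norm_nested_axialFn_sub_le` (fat loop), ★★★`norm_compT_bgT_sub_axialFn_le` (THE ROW).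
CONSUMERS: ★p1 g19 (B2a-F2) `E_y` identity; px3 g6 (B2a-F4-B).  The member reading (`V := W♯ = pull (bgUnits F K W) (basePt F n K)`, `α₀ := 2e` from `RegPr`) is the consumer's.
HONEST SCOPE.  Lattice holonomy bookkeeping over the lit-balaban cell's certified Prop. 1–2 tower ([folklore] compositions); nothing of (B2a), (REC), `hN06`, the stub or the crux here.

References: T. Bałaban, CMP 99 (1985) 389–434 [Balaban1985BackgroundPropagators] ((3.19) p.393); CMP 98 (1985) 17–51 [Balaban1985Averaging] ((42)–(43) pp.23–24, pp.24–25,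
(52)–(54) p.26, (78)–(80) p.30); CMP 99 (1985) 75–102 [Balaban1985RegularSpaces] ((1.70) p.88).
-/

set_option autoImplicit false

noncomputable section

open scoped BigOperators

namespace Summit.QuantumFields.YangMills.Theorems.Prop7CombVsAxialTransport

open Literature.MathematicalPhysics.QuantumFieldTheory.Balaban1983to89
open Literature.MathematicalPhysics.QuantumLattice (blockMap blockBase blockSites mem_blockSites_iff blockBase_one blockMap_one)
open B7BlockGeometry (blockMap_blockMap)
open B7Prop1Explicit (Site Letter e hol seg treeWord axialFn gaugeAct U1 l1 disp stepHol hol_cons hol_nil hol_append disp_cons disp_nil disp_append disp_seg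
  disp_treeWord length_treeWord hol_mem axialFn_mem gaugeAct_mem mem_U1 hol_gaugeAct stepHol_true plaqWord)
open B7Prop2Explicit (pdev le_pdev avgIter C0 c2' C0_pos AvgClosed avgIter_mem)
open B8Eq119TwistedAxial (bgT)
open B8Lemma1NonAbelian (PlaqSmall axial_bond_bound_sharp lowPart lowPart_nonneg lowPart_le_self tw tw_nil tw_cons treeWord_eq_tw
  forward_of_mem_treeWord disp_nonneg_of_forward e_nonneg)
open B7Eq47AveragedBondVsStraight (norm_avgIter_sub_straight_le norm_hol_seg_sub_hol_seg_le)
open B8Eq115GaugeFixing (axialFn_gaugeAct axialFn_self)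
open B9B8AveragingKernelZd (blockIter compT compT_zero compT_succ mem_blockIter_iff blockIter_zero)
open B8Ineq170 (norm_mul_sub_one_le_of_norm_le_one)

variable {d : ℕ} {𝔸 : Type*} [NormedRing 𝔸] [NormOneClass 𝔸]

/-! ## §1 Letters: unit-ball telescoping, forward words, block offsets -/

/-- **unit-ball telescoping** `‖P·a − Q·b‖ ≤ ‖P − Q‖ + ‖a − b‖` for units `P`, `b` of norm `≤ 1` (`P·a − Q·b = P(a − b) + (P − Q)b`). [folklore] -/
theorem norm_units_mul_sub_mul_le {P b : 𝔸ˣ} (hP : P ∈ U1 𝔸) (hb : b ∈ U1 𝔸) (Q a : 𝔸) :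
    ‖(P : 𝔸) * a - Q * (b : 𝔸)‖ ≤ ‖(P : 𝔸) - Q‖ + ‖a - (b : 𝔸)‖ := by
  rw [show (P : 𝔸) * a - Q * (b : 𝔸) = (P : 𝔸) * (a - b) + ((P : 𝔸) - Q) * b by noncomm_ring]
  refine (norm_add_le _ _).trans ?_
  have h1 : ‖(P : 𝔸) * (a - b)‖ ≤ ‖a - (b : 𝔸)‖ := (norm_mul_le _ _).trans (mul_le_of_le_one_left (norm_nonneg _) (mem_U1.1 hP).1)
  have h2 : ‖((P : 𝔸) - Q) * b‖ ≤ ‖(P : 𝔸) - Q‖ := (norm_mul_le _ _).trans (mul_le_of_le_one_right (norm_nonneg _) (mem_U1.1 hb).1)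
  linarith

/-- ★ **A FORWARD WORD WITH `θ`-SMALL BONDS HAS `|w|·θ`-SMALL HOLONOMY**: if every letter of `w` is a forward step and every bond `(z + disp w₁, l.1)` met along `w`
(`w = w₁ ++ l :: w₂`) satisfies `‖W − 1‖ ≤ θ`, then `‖W(z; w) − 1‖ ≤ |w|·θ` (unit-bounded `W`; `‖ab − 1‖ ≤ ‖a − 1‖ + ‖b − 1‖`). [cite: Balaban1985RegularSpaces, (1.70) p.88] -/
theorem norm_hol_sub_one_le_length_mul {W : Site d → Fin d → 𝔸ˣ} (hW : ∀ x κ, W x κ ∈ U1 𝔸) {θ : ℝ} :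
    ∀ (w : List (Letter d)) (z : Site d), (∀ l ∈ w, l = (l.1, true)) →
      (∀ (w₁ w₂ : List (Letter d)) (l : Letter d), w = w₁ ++ l :: w₂ → ‖((W (z + disp w₁) l.1 : 𝔸ˣ) : 𝔸) - 1‖ ≤ θ) →
      ‖((hol W z w : 𝔸ˣ) : 𝔸) - 1‖ ≤ w.length * θ
  | [], z, _, _ => by simp
  | (μ, b) :: w, z, hfw, hθ => by
    have hb : b = true := by simpa using hfw (μ, b) (by simp)
    subst hb
    rw [hol_cons, stepHol_true, Units.val_mul, List.length_cons, Nat.cast_succ, add_mul, one_mul, B7Prop1Explicit.Letter.vec_true]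
    have h0 : ‖((W z μ : 𝔸ˣ) : 𝔸) - 1‖ ≤ θ := by simpa using hθ [] w (μ, true) rfl
    have ih := norm_hol_sub_one_le_length_mul hW w (z + e μ) (fun l hl => hfw l (List.mem_cons_of_mem _ hl))
      (fun w₁ w₂ l hsplit => by
        have h := hθ ((μ, true) :: w₁) w₂ l (by rw [hsplit]; rfl)
        rwa [disp_cons, B7Prop1Explicit.Letter.vec_true, ← add_assoc] at h)
    have hn : ‖((W z μ : 𝔸ˣ) : 𝔸)‖ ≤ 1 := (mem_U1.1 (hW z μ)).1
    calc _ ≤ ‖((W z μ : 𝔸ˣ) : 𝔸) - 1‖ + ‖((hol W (z + e μ) w : 𝔸ˣ) : 𝔸) - 1‖ := norm_mul_sub_one_le_of_norm_le_one hn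
      _ ≤ θ + w.length * θ := add_le_add h0 ih
      _ = w.length * θ + θ := by ring

/-- `|v|₁ ≤ d·R` when every coordinate of `v ≥ 0` is `≤ R`. [folklore] -/
theorem l1_le_mul_of_le {v : Site d} (hv : 0 ≤ v) {R : ℕ} (hR : ∀ i, v i ≤ R) : l1 v ≤ d * R := by
  calc ∑ κ, (v κ).natAbs ≤ ∑ _κ : Fin d, R := Finset.sum_le_sum fun κ _ => by
          have h0 : 0 ≤ v κ := by simpa using hv κ
          have h2 : ((v κ).natAbs : ℤ) ≤ R := by rw [Int.natAbs_of_nonneg h0]; exact hR κ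
          exact_mod_cast h2
    _ = d * R := by simp

/-- a site of the block `B_M(y)` is the corner plus an offset in `[0, M)ᵈ`. [cite: Balaban1985Averaging, (2) p.17] -/
theorem exists_offset_of_mem_blockSites {M : ℕ} {y x : Site d} (hx : x ∈ blockSites M y) :
    ∃ t : Fin d → ℕ, (∀ i, t i < M) ∧ x = blockBase M y + fun i => (t i : ℤ) := by
  simp only [blockSites, Finset.mem_image, Fintype.mem_piFinset, Finset.mem_range] at hx
  obtain ⟨t, ht, rfl⟩ := hx; exact ⟨t, ht, rfl⟩

/-- the `j`-th block ancestor is the `Lʲ`-block map: `blockMap^[j] = blockMap (Lʲ)` (nested blocks). [cite: Balaban1985Averaging, (43) p.24] -/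
theorem iterate_blockMap_eq (L : ℕ) : ∀ (j : ℕ) (x : Site d), (blockMap L)^[j] x = blockMap (L ^ j) x
  | 0, x => by simp
  | j + 1, x => by rw [Function.iterate_succ_apply, iterate_blockMap_eq L j, blockMap_blockMap, pow_succ']

/-- scaling of corners: `M • blockBase L y = blockBase (M·L) y`, coordinatewise. [folklore] -/
theorem smul_blockBase (M L : ℕ) (y : Site d) : (M : ℤ) • blockBase L y = blockBase (M * L) y := by
  funext i; simp only [Pi.smul_apply, smul_eq_mul, blockBase, Nat.cast_mul]; ring

/-! ## §2 A coarse tree word against the `M`-scaled fine tree word -/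

/-- ★ **TREE WORDS, DIRECTION BY DIRECTION**: if every coarse bond variable `W(z, κ)` is within `E` of the fine transporter `V(Mz; seg_κ M)`, then along `tw ks v` (`v ≥ 0`)
the coarse transporter from `z` is within `(Σ_{κ∈ks}|v_κ|)·E` of the fine transporter from `Mz` along `tw ks (Mv)` (✓`norm_hol_seg_sub_hol_seg_le` per direction, unit-ball
telescoping across directions). [cite: Balaban1985Averaging, (9) p.18, (43) p.24] -/
theorem norm_hol_tw_sub_hol_tw_smul_le {W V : Site d → Fin d → 𝔸ˣ} (hW : ∀ x κ, W x κ ∈ U1 𝔸) (hV : ∀ x κ, V x κ ∈ U1 𝔸)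
    (M : ℕ) {E : ℝ} (hE : 0 ≤ E)
    (hbond : ∀ (z : Site d) (κ : Fin d), ‖((W z κ : 𝔸ˣ) : 𝔸) - ((hol V ((M : ℤ) • z) (seg κ (M : ℤ)) : 𝔸ˣ) : 𝔸)‖ ≤ E) :
    ∀ (ks : List (Fin d)) (v : Site d), 0 ≤ v → ∀ z : Site d,
      ‖((hol W z (tw ks v) : 𝔸ˣ) : 𝔸) - ((hol V ((M : ℤ) • z) (tw ks ((M : ℤ) • v)) : 𝔸ˣ) : 𝔸)‖ ≤ (ks.map fun κ => ((v κ).natAbs : ℝ)).sum * E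
  | [], v, _, z => by simp
  | κ :: ks, v, hv, z => by
    rw [tw_cons, tw_cons, hol_append, hol_append, Units.val_mul, Units.val_mul, List.map_cons, List.sum_cons, add_mul]
    obtain ⟨n, hn⟩ := Int.eq_ofNat_of_zero_le (hv κ)
    have hseg : ‖((hol W z (seg κ (v κ)) : 𝔸ˣ) : 𝔸) - ((hol V ((M : ℤ) • z) (seg κ (((M : ℤ) • v) κ)) : 𝔸ˣ) : 𝔸)‖ ≤ n * E := by
      have h := norm_hol_seg_sub_hol_seg_le hW hV M z ((M : ℤ) • z) κ hE n (fun i _ => by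
        have e1 : (M : ℤ) • (z + (i : ℤ) • e κ) = (M : ℤ) • z + ((i * M : ℕ) : ℤ) • e κ := by rw [smul_add, smul_smul, Nat.cast_mul, mul_comm]
        simpa only [e1] using hbond (z + (i : ℤ) • e κ) κ)
      have e2 : ((M : ℤ) • v) κ = ((n * M : ℕ) : ℤ) := by rw [Pi.smul_apply, smul_eq_mul, hn, Nat.cast_mul]; ring
      rw [hn, e2]; exact h
    have hdisp : (M : ℤ) • z + disp (seg κ (((M : ℤ) • v) κ)) = (M : ℤ) • (z + disp (seg κ (v κ))) := by
      rw [disp_seg, disp_seg, Pi.smul_apply, smul_eq_mul, smul_add, smul_smul]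
    rw [hdisp, show ((v κ).natAbs : ℝ) = n by rw [hn]; simp]
    exact (norm_units_mul_sub_mul_le (hol_mem hW _ _) (hol_mem hV _ _) _ _).trans
      (add_le_add hseg (norm_hol_tw_sub_hol_tw_smul_le hW hV M hE hbond ks v hv (z + disp (seg κ (v κ)))))

/-- ★★ **THE TREE WORD**: `‖W(z; Γ_{z,z+v}) − V(Mz; Γ_{Mz, Mz+Mv})‖ ≤ |v|₁·E` (`v ≥ 0`) — the coarse axial transporter against the fine one along the `M`-scaled tree contour.
[cite: Balaban1985Averaging, (9) p.18, (43) p.24, p.24 (tree contours)] -/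
theorem norm_hol_treeWord_sub_hol_treeWord_le {W V : Site d → Fin d → 𝔸ˣ} (hW : ∀ x κ, W x κ ∈ U1 𝔸) (hV : ∀ x κ, V x κ ∈ U1 𝔸)
    (M : ℕ) {E : ℝ} (hE : 0 ≤ E)
    (hbond : ∀ (z : Site d) (κ : Fin d), ‖((W z κ : 𝔸ˣ) : 𝔸) - ((hol V ((M : ℤ) • z) (seg κ (M : ℤ)) : 𝔸ˣ) : 𝔸)‖ ≤ E)
    (v : Site d) (hv : 0 ≤ v) (z : Site d) :
    ‖((hol W z (treeWord v) : 𝔸ˣ) : 𝔸) - ((hol V ((M : ℤ) • z) (treeWord ((M : ℤ) • v)) : 𝔸ˣ) : 𝔸)‖ ≤ (l1 v : ℝ) * E := by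
  rw [treeWord_eq_tw, treeWord_eq_tw]
  refine (norm_hol_tw_sub_hol_tw_smul_le hW hV M hE hbond _ v hv z).trans (le_of_eq ?_)
  congr 1
  rw [List.map_reverse, List.sum_reverse, ← Fin.sum_univ_def, l1, Nat.cast_sum]

/-! ## §3 Two nested axial transporters against one (the «fat loop», paid in the axial gauge) -/

/-- ★★ **CORNER → SUB-CORNER → `x` AGAINST CORNER → `x`**: for unit-bounded `V` with all plaquettes `a`-close to `1`, corners `c ≤ c′ ≤ x` with `x − c ≤ R` coordinatewise:
`‖V(Γ_{c,c′})·V(Γ_{c′,x}) − V(Γ_{c,x})‖ ≤ |x − c′|₁·(d·R)·a`.  In the axial gauge `V₁ = V^u`, `u = axialFn V c`: `V(Γ_{c,c′})V(Γ_{c′,x}) − V(Γ_{c,x}) = (V₁(Γ_{c′,x}) − 1)·u(x)`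
(✓`hol_gaugeAct`, `u(c) = 1`, corner-rooted tree transporters of `V₁` are `1`), and every bond of `Γ_{c′,x}` is within `|z − c|₁·a ≤ dR·a` of `1` in `V₁`
(✓`axial_bond_bound_sharp`). [cite: Balaban1985Averaging, pp.24–25; Balaban1985RegularSpaces, (1.70) p.88] -/
theorem norm_axialFn_mul_axialFn_sub_axialFn_le {V : Site d → Fin d → 𝔸ˣ} (hV : ∀ x κ, V x κ ∈ U1 𝔸) {a : ℝ} (ha : 0 ≤ a)
    (hP : ∀ (x : Site d) (κ μ : Fin d), κ ≠ μ → ‖((hol V x (plaqWord κ μ) : 𝔸ˣ) : 𝔸) - 1‖ ≤ a)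
    (c c' x : Site d) (hcc' : c ≤ c') (hc'x : c' ≤ x) {R : ℕ} (hR : ∀ i, x i - c i ≤ R) :
    ‖((axialFn V c c' * axialFn V c' x : 𝔸ˣ) : 𝔸) - ((axialFn V c x : 𝔸ˣ) : 𝔸)‖ ≤ (l1 (x - c') : ℝ) * ((d * R) * a) := by
  have hu1 : ∀ z, axialFn V c z ∈ U1 𝔸 := fun z => axialFn_mem hV c z
  have hV₁m : ∀ z κ, gaugeAct (axialFn V c) V z κ ∈ U1 𝔸 := gaugeAct_mem hV hu1
  have huc : axialFn V c c = 1 := axialFn_self V c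
  -- the gauge: `hol V c W = hol V₁ c W * u (c + disp W)`; corner-rooted tree transporters of `V₁` are `1`
  have hgauge : ∀ W : List (Letter d), hol V c W = hol (gaugeAct (axialFn V c) V) c W * axialFn V c (c + disp W) := by
    intro W
    have h := hol_gaugeAct (axialFn V c) V c W
    rw [huc, one_mul] at h
    rw [h, inv_mul_cancel_right]
  have htree : ∀ z : Site d, hol (gaugeAct (axialFn V c) V) c (treeWord (z - c)) = 1 := by
    intro z
    have h := hol_gaugeAct (axialFn V c) V c (treeWord (z - c))
    rw [disp_treeWord, add_sub_cancel, huc, one_mul] at h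
    rw [h]; exact mul_inv_cancel _
  have hprod : axialFn V c c' * axialFn V c' x = hol V c (treeWord (c' - c) ++ treeWord (x - c')) := by
    show hol V c (treeWord (c' - c)) * hol V c' (treeWord (x - c')) = _
    rw [hol_append, disp_treeWord, add_sub_cancel]
  have hW1 : hol (gaugeAct (axialFn V c) V) c (treeWord (c' - c) ++ treeWord (x - c')) = hol (gaugeAct (axialFn V c) V) c' (treeWord (x - c')) := by
    rw [hol_append, disp_treeWord, add_sub_cancel, htree c', one_mul]
  have hd1 : c + disp (treeWord (c' - c) ++ treeWord (x - c')) = x := by rw [disp_append, disp_treeWord, disp_treeWord]; abel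
  have hd2 : c + disp (treeWord (x - c)) = x := by rw [disp_treeWord]; abel
  have key : ((axialFn V c c' * axialFn V c' x : 𝔸ˣ) : 𝔸) - ((axialFn V c x : 𝔸ˣ) : 𝔸)
      = (((hol (gaugeAct (axialFn V c) V) c' (treeWord (x - c')) : 𝔸ˣ) : 𝔸) - 1) * ((axialFn V c x : 𝔸ˣ) : 𝔸) := by
    have e1 : axialFn V c x = hol V c (treeWord (x - c)) := rfl
    rw [hprod, hgauge, hW1, hd1]
    conv_lhs => rw [e1, hgauge (treeWord (x - c)), htree x, hd2]
    push_cast; noncomm_ring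
  rw [key]
  have hxc' : 0 ≤ x - c' := sub_nonneg.2 hc'x
  have hfw : ∀ l ∈ treeWord (x - c'), l = (l.1, true) := fun l hl => forward_of_mem_treeWord hxc' hl
  have hpath : ‖((hol (gaugeAct (axialFn V c) V) c' (treeWord (x - c')) : 𝔸ˣ) : 𝔸) - 1‖ ≤ (treeWord (x - c')).length * ((d * R) * a) := by
    refine norm_hol_sub_one_le_length_mul hV₁m (treeWord (x - c')) c' hfw fun w₁ w₂ l hsplit => ?_
    have hl : l = (l.1, true) := hfw l (by rw [hsplit]; simp)
    have h01 : (0 : Site d) ≤ disp w₁ := disp_nonneg_of_forward fun l' hl' => hfw l' (by rw [hsplit]; simp [hl'])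
    have h02 : (0 : Site d) ≤ disp w₂ := disp_nonneg_of_forward fun l' hl' => hfw l' (by rw [hsplit]; simp [hl'])
    have hsum : disp w₁ + e l.1 + disp w₂ = x - c' := by
      have h := disp_treeWord (x - c')
      rw [hsplit, disp_append, disp_cons, hl] at h
      simpa [add_assoc] using h
    have hcz : c ≤ c' + disp w₁ := hcc'.trans (le_add_of_nonneg_right h01)
    have hPl : PlaqSmall V c (c' + disp w₁ + e l.1) a := fun x' κ μ hκμ _ _ => hP x' κ μ hκμ
    have hb := axial_bond_bound_sharp V hV hPl c (c' + disp w₁) l.1 le_rfl hcz le_rfl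
    refine hb.trans ?_
    have hzc0 : 0 ≤ c' + disp w₁ - c := sub_nonneg.2 hcz
    have hzx : c' + disp w₁ - c ≤ x - c := by
      have h3 : disp w₁ ≤ x - c' := by rw [← hsum, add_assoc]; exact le_add_of_nonneg_right (add_nonneg (e_nonneg _) h02)
      intro i
      have h4 := h3 i
      simp only [Pi.sub_apply, Pi.add_apply] at h4 ⊢
      linarith
    have hl1 : (l1 (lowPart l.1 (c' + disp w₁ - c)) : ℝ) ≤ d * R := by
      exact_mod_cast l1_le_mul_of_le (lowPart_nonneg _ hzc0) fun i =>
        ((lowPart_le_self _ hzc0) i).trans ((hzx i).trans (by simpa using hR i))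
    exact mul_le_mul_of_nonneg_right hl1 ha
  have hux : ‖((axialFn V c x : 𝔸ˣ) : 𝔸)‖ ≤ 1 := (mem_U1.1 (hu1 x)).1
  calc ‖(((hol (gaugeAct (axialFn V c) V) c' (treeWord (x - c')) : 𝔸ˣ) : 𝔸) - 1) * ((axialFn V c x : 𝔸ˣ) : 𝔸)‖
      ≤ ‖((hol (gaugeAct (axialFn V c) V) c' (treeWord (x - c')) : 𝔸ˣ) : 𝔸) - 1‖ * ‖((axialFn V c x : 𝔸ˣ) : 𝔸)‖ := norm_mul_le _ _
    _ ≤ ‖((hol (gaugeAct (axialFn V c) V) c' (treeWord (x - c')) : 𝔸ˣ) : 𝔸) - 1‖ := mul_le_of_le_one_right (norm_nonneg _) hux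
    _ ≤ (treeWord (x - c')).length * ((d * R) * a) := hpath
    _ = (l1 (x - c') : ℝ) * ((d * R) * a) := by rw [length_treeWord]

/-! ## §4 ★★★ The row: the comb transporter against the one-shot axial transporter -/

/-- the closing arithmetic of the induction: `256Pα₀·(L−1)∕L² + 87Pα₀∕L² + qα₀∕L ≤ 87Pα₀` for `L ≥ 2`, `0 ≤ q ≤ P`, `0 ≤ α₀` (`(L−1)∕L² ≤ ¼`, `1∕L² ≤ ¼`, `1∕L ≤ ½`).
[folklore] -/
theorem closing_arith {P α₀ L q : ℝ} (hL : 2 ≤ L) (hP : 0 ≤ P) (hα : 0 ≤ α₀) (hq0 : 0 ≤ q) (hq : q ≤ P) :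
    256 * P * α₀ * ((L - 1) * (L ^ 2)⁻¹) + 87 * P * α₀ * (L ^ 2)⁻¹ + q * α₀ * L⁻¹ ≤ 87 * P * α₀ := by
  have hL0 : 0 < L := by linarith
  have hL2 : 0 < L ^ 2 := by positivity
  have hinvL : L⁻¹ ≤ 1 / 2 := by rw [inv_le_comm₀ hL0 (by norm_num)]; linarith
  have hinvL2 : (L ^ 2)⁻¹ ≤ 1 / 4 := by rw [inv_le_comm₀ hL2 (by norm_num)]; nlinarith
  have hLm1 : (L - 1) * (L ^ 2)⁻¹ ≤ 1 / 4 := by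
    have h4 : 4 * (L - 1) ≤ L ^ 2 := by nlinarith [sq_nonneg (L - 2)]
    calc (L - 1) * (L ^ 2)⁻¹ ≤ (L ^ 2 / 4) * (L ^ 2)⁻¹ := by gcongr; linarith
      _ = 1 / 4 := by field_simp
  have k1 := mul_le_mul_of_nonneg_left hLm1 (by positivity : (0 : ℝ) ≤ 256 * P * α₀)
  have k2 := mul_le_mul_of_nonneg_left hinvL2 (by positivity : (0 : ℝ) ≤ 87 * P * α₀)
  have k3 := mul_le_mul_of_nonneg_left hinvL (by positivity : (0 : ℝ) ≤ q * α₀)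
  have k4 := mul_le_mul_of_nonneg_right hq hα
  have hPa : 0 ≤ P * α₀ := mul_nonneg hP hα
  nlinarith [k1, k2, k3, k4, hPa]

section Row

variable [NormedAlgebra ℂ 𝔸] [CompleteSpace 𝔸]

/-- ★ **THE OUTER LEG** (step (i)): under the Prop. 2 tower hypotheses at `k + 1` levels, the leg `Ū^k(Γ_{Ly,x′}) = bgT L V k y x′` of the comb (`x′ ∈ B(y)`) is within
`d(L−1)·256(d+1)(d+4)α₀∕L²` of the FINE axial transporter from the corner of the `L^{k+1}`-block of `y` to the corner of the `Lᵏ`-block of `x′` (✓`norm_avgIter_sub_straight_le` per averaged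
bond — area count `(Lᵏ∕L^{k+1})² = L⁻²` —, §2 along the tree word). [cite: Balaban1985Averaging, (42)–(43) pp.23–24, (52)–(54) p.26, (78)–(80) p.30] -/
theorem norm_bgT_sub_axialFn_le (L : ℕ) (hL : 2 ≤ L) {G : Subgroup 𝔸ˣ} (hG : AvgClosed d L G) (V : Site d → Fin d → 𝔸ˣ) (hV : ∀ x κ, V x κ ∈ G) (k : ℕ)
    {α₀ : ℝ} (hα : 0 < α₀) (hα3 : C0 d * α₀ ≤ 1 / 3) (hα2 : 2 * α₀ ≤ c2' d L) (h52 : pdev V < α₀ * (((L : ℝ) ^ (k + 1))⁻¹) ^ 2)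
    {y x' : Site d} (hx' : x' ∈ blockSites L y) :
    ‖((bgT L V k y x' : 𝔸ˣ) : 𝔸) - ((axialFn V (blockBase (L ^ (k + 1)) y) (blockBase (L ^ k) x') : 𝔸ˣ) : 𝔸)‖
      ≤ d * ((L : ℝ) - 1) * (256 * (d + 1) * (d + 4) * α₀ * ((L : ℝ) ^ 2)⁻¹) := by
  have hL1 : 1 ≤ L := le_trans (by norm_num) hL
  have hL0 : (0 : ℝ) < L := by exact_mod_cast (lt_of_lt_of_le (by norm_num) hL)
  have hV1 : ∀ x κ, V x κ ∈ U1 𝔸 := fun x κ => hG.le_U1 (hV x κ)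
  have hWk : ∀ z κ, avgIter L V k z κ ∈ U1 𝔸 := fun z κ => hG.le_U1 (avgIter_mem L hL hG (k + 1) V hV hα hα3 hα2 h52 k (Nat.le_succ k) z κ)
  obtain ⟨s, hs, hx'eq⟩ := exists_offset_of_mem_blockSites hx'
  set E : ℝ := 256 * (d + 1) * (d + 4) * α₀ * ((L : ℝ) ^ 2)⁻¹ with hEdef
  have hE0 : 0 ≤ E := by rw [hEdef]; positivity
  have hratio : ((L : ℝ) ^ k * ((L : ℝ) ^ (k + 1))⁻¹) ^ 2 = ((L : ℝ) ^ 2)⁻¹ := by field_simp; ring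
  have hbond : ∀ (z : Site d) (κ : Fin d), ‖((avgIter L V k z κ : 𝔸ˣ) : 𝔸) - ((hol V (((L ^ k : ℕ) : ℤ) • z) (seg κ ((L ^ k : ℕ) : ℤ)) : 𝔸ˣ) : 𝔸)‖ ≤ E := by
    intro z κ
    have h := norm_avgIter_sub_straight_le L hL hG (k + 1) V hV hα hα3 hα2 h52 k (Nat.le_succ k) z κ
    rw [hratio] at h
    rw [Nat.cast_pow, hEdef]
    exact h
  have hs0 : (0 : Site d) ≤ fun i => (s i : ℤ) := fun i => by simp
  have hleg := norm_hol_treeWord_sub_hol_treeWord_le hWk hV1 (L ^ k) hE0 hbond (fun i => (s i : ℤ)) hs0 (blockBase L y)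
  have ebgT : bgT L V k y x' = hol (avgIter L V k) (blockBase L y) (treeWord fun i => (s i : ℤ)) := by
    show axialFn (avgIter L V k) (blockBase L y) x' = _
    rw [axialFn, hx'eq, add_sub_cancel_left]
  have ec : (((L ^ k : ℕ) : ℤ)) • blockBase L y = blockBase (L ^ (k + 1)) y := by rw [smul_blockBase, ← pow_succ]
  have ec' : blockBase (L ^ k) x' = blockBase (L ^ (k + 1)) y + ((L ^ k : ℕ) : ℤ) • fun i => (s i : ℤ) := by
    rw [hx'eq, ← ec]; funext i; simp only [blockBase, Pi.add_apply, Pi.smul_apply, smul_eq_mul]; ring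
  have eA' : axialFn V (blockBase (L ^ (k + 1)) y) (blockBase (L ^ k) x')
      = hol V ((((L ^ k : ℕ) : ℤ)) • blockBase L y) (treeWord ((((L ^ k : ℕ) : ℤ)) • fun i => (s i : ℤ))) := by
    rw [axialFn, ec', ec, add_sub_cancel_left]
  have hl1s : (l1 (fun i => (s i : ℤ)) : ℝ) ≤ d * ((L : ℝ) - 1) := by
    have h := l1_le_mul_of_le hs0 (R := L - 1) fun i => by have := hs i; show (s i : ℤ) ≤ ((L - 1 : ℕ) : ℤ); omega
    have hcast : ((L - 1 : ℕ) : ℝ) = (L : ℝ) - 1 := by rw [Nat.cast_sub hL1, Nat.cast_one]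
    calc (l1 (fun i => (s i : ℤ)) : ℝ) ≤ ((d * (L - 1) : ℕ) : ℝ) := by exact_mod_cast h
      _ = d * ((L : ℝ) - 1) := by rw [Nat.cast_mul, hcast]
  rw [ebgT, eA']
  exact hleg.trans (mul_le_mul_of_nonneg_right hl1s hE0)

omit [NormedAlgebra ℂ 𝔸] [CompleteSpace 𝔸] in
/-- ★ **THE FAT LOOP AT THE BLOCK** (step (iii)): for unit-bounded `V` with all plaquettes `a`-close to `1`, `x′ ∈ B(y)` and `x ∈ B_{Lᵏ}(x′)`: the two nested axial transporters
(big corner → sub-corner → `x`) against the one (big corner → `x`) differ by `≤ (d·Lᵏ)·(d·L^{k+1})·a` (§3 with `|x − c′|₁ ≤ dLᵏ`, `x − c ≤ L^{k+1}`). [cite: Balaban1985Averaging, pp.24–25] -/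
theorem norm_nested_axialFn_sub_le {V : Site d → Fin d → 𝔸ˣ} (hV : ∀ x κ, V x κ ∈ U1 𝔸) {a : ℝ} (ha : 0 ≤ a)
    (hP : ∀ (x : Site d) (κ μ : Fin d), κ ≠ μ → ‖((hol V x (plaqWord κ μ) : 𝔸ˣ) : 𝔸) - 1‖ ≤ a)
    (L : ℕ) (hL : 1 ≤ L) (k : ℕ) {y x' x : Site d} (hx' : x' ∈ blockSites L y) (hx : x ∈ blockSites (L ^ k) x') :
    ‖((axialFn V (blockBase (L ^ (k + 1)) y) (blockBase (L ^ k) x') * axialFn V (blockBase (L ^ k) x') x : 𝔸ˣ) : 𝔸)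
        - ((axialFn V (blockBase (L ^ (k + 1)) y) x : 𝔸ˣ) : 𝔸)‖ ≤ (d * (L : ℝ) ^ k) * ((d * ((L ^ (k + 1) : ℕ) : ℝ)) * a) := by
  obtain ⟨t, ht, hxeq⟩ := exists_offset_of_mem_blockSites hx
  obtain ⟨s, hs, hx'eq⟩ := exists_offset_of_mem_blockSites hx'
  have ec : (((L ^ k : ℕ) : ℤ)) • blockBase L y = blockBase (L ^ (k + 1)) y := by rw [smul_blockBase, ← pow_succ]
  have ec' : blockBase (L ^ k) x' = blockBase (L ^ (k + 1)) y + ((L ^ k : ℕ) : ℤ) • fun i => (s i : ℤ) := by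
    rw [hx'eq, ← ec]; funext i; simp only [blockBase, Pi.add_apply, Pi.smul_apply, smul_eq_mul]; ring
  have ht0 : (0 : Site d) ≤ fun i => (t i : ℤ) := fun i => by simp
  have hcc' : blockBase (L ^ (k + 1)) y ≤ blockBase (L ^ k) x' := by
    rw [ec']; exact le_add_of_nonneg_right (fun i => by simp only [Pi.smul_apply, smul_eq_mul, Pi.zero_apply]; positivity)
  have hc'x : blockBase (L ^ k) x' ≤ x := by rw [hxeq]; exact le_add_of_nonneg_right ht0
  have hR : ∀ i, x i - blockBase (L ^ (k + 1)) y i ≤ (L ^ (k + 1) : ℕ) := by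
    intro i
    rw [hxeq, ec']; simp only [Pi.add_apply, Pi.smul_apply, smul_eq_mul]
    have h1 : (s i : ℤ) ≤ (L : ℤ) - 1 := by have := hs i; omega
    have h2 : (t i : ℤ) ≤ ((L ^ k : ℕ) : ℤ) - 1 := by have := ht i; omega
    have h3 : (0 : ℤ) ≤ ((L ^ k : ℕ) : ℤ) := by positivity
    have h4 : ((L ^ k : ℕ) : ℤ) * (s i : ℤ) ≤ ((L ^ k : ℕ) : ℤ) * ((L : ℤ) - 1) := mul_le_mul_of_nonneg_left h1 h3
    have h5 : ((L ^ (k + 1) : ℕ) : ℤ) = ((L ^ k : ℕ) : ℤ) * (L : ℤ) := by push_cast; ring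
    linarith
  have hmain := norm_axialFn_mul_axialFn_sub_axialFn_le hV ha hP (blockBase (L ^ (k + 1)) y) (blockBase (L ^ k) x') x hcc' hc'x hR
  have hl1t : (l1 (x - blockBase (L ^ k) x') : ℝ) ≤ d * (L : ℝ) ^ k := by
    have h := l1_le_mul_of_le (v := x - blockBase (L ^ k) x') (by rw [hxeq, add_sub_cancel_left]; exact ht0) (R := L ^ k) fun i => by
      rw [hxeq, add_sub_cancel_left]; exact_mod_cast (ht i).le
    exact_mod_cast h
  exact hmain.trans (mul_le_mul_of_nonneg_right hl1t (by positivity))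

/-- ★★★ **(B2a-F3) THE COMB (HIERARCHICAL) TRANSPORTER IS `O(α₀)`-CLOSE TO THE ONE-SHOT AXIAL TRANSPORTER, UNIFORMLY IN THE NUMBER OF LEVELS.**  `L ≥ 2`; `V` on `ℤᵈ`
with values in an averaging-closed subgroup `G` of the unit ball, `0 < α₀`, `C₀α₀ ≤ ⅓`, `2α₀ ≤ c₂′`, (52) `sup_p |V(∂p) − 1| < α₀·L^{−2k}`.  THEN for every level-`k` site `y` and every fine
`x ∈ Bᵏ(y)`: **`‖compT L (bgT L V) k y x − axialFn V (blockBase (Lᵏ) y) x‖ ≤ 87·d·(d+1)·(d+4)·α₀`** (at `d = 3`: `7308·α₀`; ABSOLUTE in `L`, `k`).  Induction on `k` (IH at `α₀∕L²`)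
over ✓`norm_bgT_sub_axialFn_le`, ✓`norm_nested_axialFn_sub_le`, ✓`closing_arith`. [cite: Balaban1985BackgroundPropagators, (3.19) p.393; Balaban1985Averaging, (42)–(43) pp.23–24, pp.24–25, (78)–(80) p.30] -/
theorem norm_compT_bgT_sub_axialFn_le (L : ℕ) (hL : 2 ≤ L) {G : Subgroup 𝔸ˣ} (hG : AvgClosed d L G)
    (V : Site d → Fin d → 𝔸ˣ) (hV : ∀ x κ, V x κ ∈ G) :
    ∀ (k : ℕ) {α₀ : ℝ}, 0 < α₀ → C0 d * α₀ ≤ 1 / 3 → 2 * α₀ ≤ c2' d L → pdev V < α₀ * (((L : ℝ) ^ k)⁻¹) ^ 2 →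
      ∀ (y x : Site d), x ∈ blockIter L k y →
        ‖((compT L (bgT L V) k y x : 𝔸ˣ) : 𝔸) - ((axialFn V (blockBase (L ^ k) y) x : 𝔸ˣ) : 𝔸)‖ ≤ 87 * d * (d + 1) * (d + 4) * α₀ := by
  intro k
  induction k with
  | zero =>
      intro α₀ hα _ _ _ y x hx
      rw [blockIter_zero, Finset.mem_singleton] at hx
      subst hx
      rw [compT_zero, pow_zero, blockBase_one, axialFn_self, sub_self, norm_zero]; positivity
  | succ k ihk =>
      intro α₀ hα hα3 hα2 h52 y x hx
      haveI : NeZero L := ⟨by omega⟩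
      have hL1 : 1 ≤ L := le_trans (by norm_num) hL
      have hLr : (2 : ℝ) ≤ L := by exact_mod_cast hL
      have hV1 : ∀ x κ, V x κ ∈ U1 𝔸 := fun x κ => hG.le_U1 (hV x κ)
      -- the level-`k` ancestor `x′` of `x`
      obtain ⟨x', hx'def⟩ : ∃ x' : Site d, x' = (blockMap L)^[k] x := ⟨_, rfl⟩
      have hx'mem : x' ∈ blockSites L y := by
        rw [mem_blockSites_iff, hx'def, ← Function.iterate_succ_apply' (f := blockMap L)]; exact (mem_blockIter_iff L (k + 1) y x).1 hx
      have hxmem : x ∈ blockIter L k x' := (mem_blockIter_iff L k x' x).2 hx'def.symm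
      have hxmem' : x ∈ blockSites (L ^ k) x' := by
        haveI : NeZero (L ^ k) := ⟨pow_ne_zero _ (NeZero.ne L)⟩
        rw [mem_blockSites_iff, ← iterate_blockMap_eq, ← hx'def]
      -- (ii) the induction hypothesis on the sub-block, at `α₀ / L²`
      have hL2 : (0 : ℝ) < (L : ℝ) ^ 2 := by positivity
      have hα' : 0 < α₀ / (L : ℝ) ^ 2 := div_pos hα hL2
      have hα'le : α₀ / (L : ℝ) ^ 2 ≤ α₀ := div_le_self hα.le (by nlinarith)
      have h52' : pdev V < α₀ / (L : ℝ) ^ 2 * (((L : ℝ) ^ k)⁻¹) ^ 2 := by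
        have e1 : α₀ / (L : ℝ) ^ 2 * (((L : ℝ) ^ k)⁻¹) ^ 2 = α₀ * (((L : ℝ) ^ (k + 1))⁻¹) ^ 2 := by field_simp; ring
        rw [e1]; exact h52
      have hα3' : C0 d * (α₀ / (L : ℝ) ^ 2) ≤ 1 / 3 := (mul_le_mul_of_nonneg_left hα'le (C0_pos d).le).trans hα3
      have hα2' : 2 * (α₀ / (L : ℝ) ^ 2) ≤ c2' d L := by linarith
      have ih := ihk hα' hα3' hα2' h52' x' x hxmem
      have hi := norm_bgT_sub_axialFn_le L hL hG V hV k hα hα3 hα2 h52 hx'mem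
      have hpl : ∀ (z : Site d) (κ μ : Fin d), κ ≠ μ → ‖((hol V z (plaqWord κ μ) : 𝔸ˣ) : 𝔸) - 1‖ ≤ α₀ * (((L : ℝ) ^ (k + 1))⁻¹) ^ 2 :=
        fun z κ μ _ => (le_pdev hV1 z κ μ).trans h52.le
      have hiii := norm_nested_axialFn_sub_le hV1 (by positivity) hpl L hL1 k hx'mem hxmem'
      have hWk : ∀ z κ, avgIter L V k z κ ∈ U1 𝔸 := fun z κ => hG.le_U1 (avgIter_mem L hL hG (k + 1) V hV hα hα3 hα2 h52 k (Nat.le_succ k) z κ)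
      have hbgT1 : bgT L V k y x' ∈ U1 𝔸 := axialFn_mem hWk _ _
      have hA''1 : axialFn V (blockBase (L ^ k) x') x ∈ U1 𝔸 := axialFn_mem hV1 _ _
      have h12 : ‖((compT L (bgT L V) (k + 1) y x : 𝔸ˣ) : 𝔸)
          - ((axialFn V (blockBase (L ^ (k + 1)) y) (blockBase (L ^ k) x') * axialFn V (blockBase (L ^ k) x') x : 𝔸ˣ) : 𝔸)‖
          ≤ d * ((L : ℝ) - 1) * (256 * (d + 1) * (d + 4) * α₀ * ((L : ℝ) ^ 2)⁻¹) + 87 * d * (d + 1) * (d + 4) * (α₀ / (L : ℝ) ^ 2) := by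
        rw [compT_succ, ← hx'def, Units.val_mul, Units.val_mul]
        exact (norm_units_mul_sub_mul_le hbgT1 hA''1 _ _).trans (add_le_add hi ih)
      refine ((norm_sub_le_norm_sub_add_norm_sub _ _ _).trans (add_le_add h12 hiii)).trans ?_
      set P : ℝ := (d : ℝ) * (d + 1) * (d + 4) with hPdef
      have hP0 : 0 ≤ P := by rw [hPdef]; positivity
      have hd2 : (d : ℝ) ^ 2 ≤ P := by
        have hd0 : (0 : ℝ) ≤ d := by positivity
        rw [hPdef]; calc (d : ℝ) ^ 2 = d * d * 1 := by ring
          _ ≤ d * (d + 1) * (d + 4) := by gcongr <;> linarith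
      have e2 : (d : ℝ) * ((L : ℝ) - 1) * (256 * (d + 1) * (d + 4) * α₀ * ((L : ℝ) ^ 2)⁻¹) = 256 * P * α₀ * (((L : ℝ) - 1) * ((L : ℝ) ^ 2)⁻¹) := by
        rw [hPdef]; ring
      have e3 : 87 * (d : ℝ) * (d + 1) * (d + 4) * (α₀ / (L : ℝ) ^ 2) = 87 * P * α₀ * ((L : ℝ) ^ 2)⁻¹ := by rw [hPdef, div_eq_mul_inv]; ring
      have e4 : (d : ℝ) * (L : ℝ) ^ k * ((d * ((L ^ (k + 1) : ℕ) : ℝ)) * (α₀ * (((L : ℝ) ^ (k + 1))⁻¹) ^ 2)) = (d : ℝ) ^ 2 * α₀ * (L : ℝ)⁻¹ := by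
        rw [Nat.cast_pow]; field_simp; ring
      have e5 : 87 * (d : ℝ) * (d + 1) * (d + 4) * α₀ = 87 * P * α₀ := by rw [hPdef]; ring
      rw [e2, e3, e4, e5]
      exact closing_arith hLr hP0 hα.le (by positivity) hd2

end Row

end Summit.QuantumFields.YangMills.Theorems.Prop7CombVsAxialTransport

end
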